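import Literature.Analysis.FunctionSpaces.PV1Saturation
import HarnessLib

/-!
# Models of `PV₁`: monotone bounds, pairing, sharply bounded search, and tables

Fifth layer of the in-model toolkit for the model-theoretic proof of
`S2PV_one_isConservativeOver_PV1` (Buss 1986, Ch. 6; Krajíček 1995, §5.3, Thm. 7.6.3), on top of
`PV1Saturation.lean`.  Sequence coding in `PV₁` must be done by explicit `PV` symbols whose
decoding properties are *provable by open `PIND`* (there is no `Σᵇ₁`-induction to develop
Euclidean division), and the witnessing / collection arguments need *monotone* bounds although
the bounding terms of `L(PV)`-formulas are arbitrary `PV` symbols.  This file supplies, with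
specifications valid **in every model of `PV₁`**:

## Part I. Monotone bounding symbols (Buss 1986, §6.1; Cook 1975, §2)

* `PVFun.IsMono` — the monotone fragment (`0, πᵢ, s_b, ⌊·/2⌋, |·|, #, +, ·`, composition) and
  `PVFun.bound f`, a bounding symbol in it for every `f : PVFun n`;
* `PV1.papp_mono` (monotone symbols are monotone; the input is the **monotonicity of `#`**,
  `PV1.mSmash_le_mSmash`, from `BASIC` 17–18 and the length law of `mspLen`), and
  **`PV1.papp_le_bound`: `f(x̄) ≤ bound f (x̄)`** (a recursion `limRec g h k` is bounded by its own
  `k`, `cond` by the sum of its branches); growth facts `x < 1 # x`, `|x| ≤ x`.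

## Part II. Shifting, low parts, pairing (Buss 1986, §2.5)

* `PVFun.sh (w, t) = w · (1 # t)`, `PVFun.low (p, t) = p mod 2^{|t|}` (limited recursion on `t`
  collecting the bits `par (mspLen (p, t'))`); the **Euclidean decomposition**
  `p = sh (mspLen (p,t), t) + low (p,t)`, `low (p,t) < 1 # t` and its uniqueness
  (`PV1.sh_msp_add_low`, `PV1.low_lt`, `PV1.sh_add_inj`);
* pairing `⟨w, y⟩_t := sh (w, t) + y` (`PVFun.pairF`) with the projections `PV1.msp_pair`,
  `PV1.low_pair` for `y ≤ t`, and monotone bounds (`PV1.pairF_le`, `PV1.pairF_lt_sh_succ`);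
* **sharply bounded search** `lsearch G` (`PVTables.lean`): `PV1.lsearch_le`,
  `PV1.ne_zero_of_lt_lsearch`, `PV1.eq_zero_of_lsearch_le`, whence
  `(∃ i ≤ |u|, G(ȳ,i) = 0) ↔ lsearch G (ȳ,u) ≤ |u|` (Buss 1986, §6.1: sharply bounded
  quantifiers over open matrices are open in `PV₁`).

## Part III. Tables (Buss 1986, §2.5; Krajíček 1995, proof of Thm. 7.6.3)

* `PVFun.tbl' G (c̄, B, s)` codes `min (G(c̄, z), B)` for `z = 0, …, |s|` in blocks of `|B|`
  bits (`T(s_j s') = ⟨T(s'), e⟩_B`, bound `(s₁ s) # B`); `PVFun.drop`, `PVFun.entry'` decode;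
* the recursion equations without truncation and the strict size invariant (`PV1.tbl'_pbit`,
  `PV1.tbl'_lt`), the shift lemma `PV1.msp_drop`, and the decoding theorem
  **`PV1.entry'_tbl'`**: for `z ≤ |s|`, `entry' (T(c̄,B,s), z, B, s) = min (G(c̄,z), B)`;
  summary `PV1.exists_table` ("as `M'` is a model of `PV₁` there is `w = ⟨u₀, …, u_{|b|}⟩`",
  Krajíček 1995, p. 116).

## References

* S. R. Buss, *Bounded Arithmetic*, Bibliopolis 1986, §2.2 (axioms 17, 18), §2.5, §6.1.
* S. A. Cook, *Feasibly constructive proofs and the propositional calculus*, STOC 1975, §2.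
* J. Krajíček, *Bounded Arithmetic, Propositional Logic and Complexity Theory*, CUP 1995, §5.3,
  Thm. 7.6.3.

## Design choices

* Same setting as `PV1Model.lean` (`[Language.pv.Structure M]`, local instance `pvReduct M`,
  `[M ⊨ BASIC]` for notation, `(hM : M ⊨ PV1)` explicit); in-model facts in the namespace `PV1`,
  new symbols in the namespace `PVFun` (their semantics on `ℕ` is not needed and mostly not
  stated: the specifications that matter are the in-model ones).
* Uniform recipe for a recursion `F = limRec g h k` in a model: `F ≤ k` is free
  (`PV1.papp_limRec_le`); the step equation is untruncated once the step value is shown `≤ k`,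
  which is either immediate or carried as a (strict) invariant through an open `PIND`.
-/

namespace Literature.Analysis.FunctionSpaces

open FirstOrder FirstOrder.Language FirstOrder.Language.BoundedFormula
open Literature.Computability.MetaComplexity Literature.Computability.MetaComplexity.BASICModel

attribute [local instance] pvReduct isExpansionOn_pvReduct

/-! # Part I. Monotone bounding symbols -/

namespace PVFun

variable {n m : ℕ}

/-- **The monotone fragment** of the `PV` symbols: `0`, projections, `s_b`, `⌊·/2⌋`, `|·|`, `#`,
`+`, `·`, closed under composition. [folklore] -/
inductive IsMono : ∀ {n : ℕ}, PVFun n → Prop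
  | zero : IsMono zero
  | proj {n : ℕ} (i : Fin n) : IsMono (proj i)
  | bit (b : Bool) : IsMono (bit b)
  | half : IsMono half
  | len : IsMono len
  | smash : IsMono smash
  | add : IsMono add
  | mul : IsMono mul
  | comp {n m : ℕ} {f : PVFun m} {g : Fin m → PVFun n} (hf : IsMono f) (hg : ∀ i, IsMono (g i)) :
      IsMono (comp f g)

/-- **The bounding symbol** of a `PV` symbol: initial symbols bound themselves, `cond (x, y, z)`
is bounded by `y + z`, a composition by the composition of the bounds, and `limRec g h k` by the
bound of `k` (Cook 1975, §2: the bounding function of a limited recursion). [cite: Cook1975, §2] -/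
def bound : ∀ {n : ℕ}, PVFun n → PVFun n
  | _, zero => zero
  | _, proj i => proj i
  | _, bit b => bit b
  | _, half => half
  | _, len => len
  | _, smash => smash
  | _, add => add
  | _, mul => mul
  | _, cond => comp add ![proj 1, proj 2]
  | _, comp f g => comp (bound f) fun i => bound (g i)
  | _, limRec _ _ k => bound k

/-- Bounding symbols lie in the monotone fragment. [folklore] -/
theorem isMono_bound : ∀ {n : ℕ} (f : PVFun n), IsMono (bound f)
  | _, zero => IsMono.zero
  | _, proj i => IsMono.proj i
  | _, bit b => IsMono.bit b
  | _, half => IsMono.half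
  | _, len => IsMono.len
  | _, smash => IsMono.smash
  | _, add => IsMono.add
  | _, mul => IsMono.mul
  | _, cond => IsMono.comp IsMono.add fun i => by
      fin_cases i <;> exact IsMono.proj _
  | _, comp f g => IsMono.comp (isMono_bound f) fun i => isMono_bound (g i)
  | _, limRec _ _ k => isMono_bound k

end PVFun

namespace PV1

variable {M : Type} [Language.pv.Structure M] [hB : M ⊨ BASIC] {n m : ℕ}

/-! ## Monotonicity of `#` and growth facts -/

/-- `x # y ≠ 0`, hence `1 ≤ x # y`. [cite: Buss1986, §2.2] -/
theorem one_le_mSmash (x y : M) : 1 ≤ mSmash x y :=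
  (one_le_iff_ne_zero' _).2 (mSmash_ne_zero x y)

/-- **`#` is monotone in its first argument** in every model of `PV₁`: if `x ≤ x'` then
`x # y ≤ x' # y` (`BASIC` 18 with the element `mspLen (x', x)` of length `|x'| - |x|`).
[cite: Buss1986, §2.2] -/
theorem mSmash_le_mSmash_left (hM : M ⊨ PV1) {x x' : M} (h : x ≤ x') (y : M) :
    mSmash x y ≤ mSmash x' y := by
  have hlen : mLen x ≤ mLen x' := mLen_le_mLen h
  have e : mLen x' = mLen x + mLen (msp x' x) := by
    rw [add_comm]; exact (mLen_msp_add hM hlen).symm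
  rw [mSmash_eq_mul_of_mLen_eq_add e y]
  calc mSmash x y = mSmash x y * 1 := (mul_one _).symm
    _ ≤ mSmash x y * mSmash (msp x' x) y := mul_le_mul'' le_rfl (one_le_mSmash _ _)

/-- **`#` is monotone** in every model of `PV₁`. [cite: Buss1986, §2.2] -/
theorem mSmash_le_mSmash (hM : M ⊨ PV1) {x x' y y' : M} (hx : x ≤ x') (hy : y ≤ y') :
    mSmash x y ≤ mSmash x' y' :=
  calc mSmash x y ≤ mSmash x' y := mSmash_le_mSmash_left hM hx y
    _ = mSmash y x' := mSmash_comm _ _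
    _ ≤ mSmash y' x' := mSmash_le_mSmash_left hM hy x'
    _ = mSmash x' y' := mSmash_comm _ _

/-- **`x < 1 # x = 2^{|x|}`** in every model of `PV₁` (open `PIND`). [cite: Buss1986, §2.2] -/
theorem lt_one_mSmash (hM : M ⊨ PV1) (x : M) : x < mSmash 1 x := by
  have hD := model_PVdef_of_model_PV1 hM
  refine IsQFPVDef.bitInd hM (P := fun x => x < mSmash 1 x) ?_ ?_ ?_ x
  · exact IsQFPVDef.lt' isPVTermFn_v0 (IsPVTermFn.one.smash isPVTermFn_v0)
  · rw [mSmash_zero' hD]; exact zero_lt_one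
  · intro b y hy ih
    rw [one_mSmash_pbit hD b y hy]
    exact (pbit_lt_pbit_iff hD b false _ _).2 (Or.inl ih)

/-- `x ≤ t → x < 1 # t`. [cite: Buss1986, §2.2] -/
theorem lt_one_mSmash_of_le (hM : M ⊨ PV1) {x t : M} (h : x ≤ t) : x < mSmash 1 t :=
  h.trans_lt (lt_one_mSmash hM t)

/-- `|x| ≤ x`. [cite: Buss1986, §2.2] -/
theorem mLen_le_self (hM : M ⊨ PV1) (x : M) : mLen x ≤ x := by
  have hD := model_PVdef_of_model_PV1 hM
  refine IsQFPVDef.bitInd hM (P := fun x => mLen x ≤ x) ?_ ?_ ?_ x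
  · exact IsQFPVDef.le' isPVTermFn_v0.len isPVTermFn_v0
  · rw [(mLen_eq_zero_iff (0 : M)).2 rfl]
  · intro b y hy ih
    rw [mLen_pbit hD hy, pbit_eq hD]
    have h1 : mLen y + 1 ≤ 2 * y + 1 := by
      rw [two_mul]; exact add_le_add (ih.trans (le_add_right'' _ _)) le_rfl
    cases b
    · -- `y ≠ 0`, so `|y| + 1 ≤ 2 y`
      have hy0 : y ≠ 0 := (pbit_false_ne_zero_iff hD y).1 hy
      simp only [Bool.false_eq_true, ↓reduceIte, add_zero]
      have : mLen y < 2 * y := by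
        calc mLen y ≤ y := ih
          _ < y + y := lt_add_of_pos_right y ((pos_iff_ne_zero' y).2 hy0)
          _ = 2 * y := (two_mul y).symm
      exact (add_one_le_iff' _ _).2 this
    · simpa using h1

/-! ## Monotone symbols are monotone; every symbol is bounded -/

/-- **Symbols of the monotone fragment are monotone** in every model of `PV₁`. [folklore] -/
theorem papp_mono (hM : M ⊨ PV1) {f : PVFun n} (hf : f.IsMono) :
    ∀ {xs ys : Fin n → M}, (∀ i, xs i ≤ ys i) → papp f xs ≤ papp f ys := by
  have hD := model_PVdef_of_model_PV1 hM
  induction hf with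
  | zero => intro xs ys _; rw [papp_zero, papp_zero]
  | proj i => intro xs ys h; rw [papp_proj hD, papp_proj hD]; exact h i
  | bit b =>
    intro xs ys h
    rw [vec1_eq' xs, vec1_eq' ys]
    change pbit b (xs 0) ≤ pbit b (ys 0)
    rcases (h 0).lt_or_eq with hlt | heq
    · exact ((pbit_lt_pbit_iff hD b b _ _).2 (Or.inl hlt)).le
    · rw [heq]
  | half =>
    intro xs ys h
    rw [vec1_eq' xs, vec1_eq' ys, papp_half, papp_half]
    exact mHalf_le_mHalf hD (h 0)
  | len =>
    intro xs ys h
    rw [vec1_eq' xs, vec1_eq' ys, papp_len, papp_len]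
    exact mLen_le_mLen (h 0)
  | smash =>
    intro xs ys h
    rw [vec2_eq' xs, vec2_eq' ys, papp_smash, papp_smash]
    exact mSmash_le_mSmash hM (h 0) (h 1)
  | add =>
    intro xs ys h
    rw [vec2_eq' xs, vec2_eq' ys, papp_add, papp_add, mAdd_eq, mAdd_eq]
    exact add_le_add (h 0) (h 1)
  | mul =>
    intro xs ys h
    rw [vec2_eq' xs, vec2_eq' ys, papp_mul, papp_mul, mMul_eq, mMul_eq]
    exact mul_le_mul'' (h 0) (h 1)
  | comp hf hg ihf ihg =>
    intro xs ys h
    rw [papp_comp hD, papp_comp hD]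
    exact ihf fun i => ihg i h

/-- **Every symbol is bounded by its bounding symbol** in every model of `PV₁`:
`f(x̄) ≤ bound f (x̄)`. [cite: Cook1975, §2] -/
theorem papp_le_bound (hM : M ⊨ PV1) : ∀ {n : ℕ} (f : PVFun n) (xs : Fin n → M),
    papp f xs ≤ papp (PVFun.bound f) xs := by
  have hD := model_PVdef_of_model_PV1 hM
  intro n f
  induction f with
  | zero => intro xs; exact le_rfl
  | proj i => intro xs; exact le_rfl
  | bit b => intro xs; exact le_rfl
  | half => intro xs; exact le_rfl
  | len => intro xs; exact le_rfl
  | smash => intro xs; exact le_rfl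
  | add => intro xs; exact le_rfl
  | mul => intro xs; exact le_rfl
  | cond =>
    intro xs
    rw [PVFun.bound, papp_comp hD, vec3_eq' xs]
    have e : (fun i => papp ((![PVFun.proj 1, PVFun.proj 2] : Fin 2 → PVFun 3) i)
        ![xs 0, xs 1, xs 2]) = ![xs 1, xs 2] := by
      funext i; fin_cases i <;> simp [papp_proj hD]
    rw [e, papp_add, mAdd_eq]
    change pcond (xs 0) (xs 1) (xs 2) ≤ xs 1 + xs 2
    rcases pcond_eq_or hD (xs 0) (xs 1) (xs 2) with h | h <;> rw [h]
    · exact le_add_right'' _ _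
    · exact le_add_left'' _ _
  | comp f g ihf ihg =>
    intro xs
    rw [PVFun.bound, papp_comp hD, papp_comp hD]
    exact (ihf _).trans (papp_mono hM (PVFun.isMono_bound f) fun i => ihg i xs)
  | limRec g h k _ _ ihk =>
    intro xs
    rw [PVFun.bound, ← Fin.snoc_init_self xs]
    exact (papp_limRec_le hD g h k _ _).trans (ihk _)

/-- The bounding symbol is monotone. [folklore] -/
theorem papp_bound_mono (hM : M ⊨ PV1) (f : PVFun n) {xs ys : Fin n → M} (h : ∀ i, xs i ≤ ys i) :
    papp (PVFun.bound f) xs ≤ papp (PVFun.bound f) ys :=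
  papp_mono hM (PVFun.isMono_bound f) h

/-- **Uniform bounds**: if the arguments are coordinatewise below `ys`, then
`f(x̄) ≤ bound f (ȳ)`. [cite: Cook1975, §2] -/
theorem papp_le_bound_of_le (hM : M ⊨ PV1) (f : PVFun n) {xs ys : Fin n → M}
    (h : ∀ i, xs i ≤ ys i) : papp f xs ≤ papp (PVFun.bound f) ys :=
  (papp_le_bound hM f xs).trans (papp_bound_mono hM f h)

end PV1


/-! # Part II. Shifting, low parts, pairing, search -/

namespace PVFun

/-- `sh (w, t) = w · (1 # t) = w · 2^{|t|}`: `w` shifted left by `|t|` bits (Buss 1986, §2.5).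
[cite: Buss1986, §2.5] -/
def sh : PVFun 2 := ap₂ mul (proj 0) (ap₂ smash one' (proj 1))

/-- `sh` on `ℕ`. [cite: Buss1986, §2.5] -/
@[simp] theorem eval_sh (v : Fin 2 → ℕ) : sh.eval v = v 0 * 2 ^ Nat.size (v 1) := by
  simp [sh]

/-- `low (p, t) = p mod 2^{|t|}`, the `|t|` low bits of `p`, by limited recursion on `t`:
`low (p, 0) = 0`, `low (p, s_i t') = low (p, t') + par (mspLen (p, t')) · (1 # t')`, bound
`1 # t` (Buss 1986, §2.5: `LSP`). [cite: Buss1986, §2.5] -/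
def low : PVFun 2 :=
  limRec zero'
    (fun _ => ap₂ add rv (ap₂ mul (ap₁ par (ap₂ mspLen (proj 0) yv)) (ap₂ smash one' yv)))
    (ap₂ smash one' lastv)

/-- Pairing `⟨w, y⟩_t = sh (w, t) + y` as a symbol of `(w, y, t)` (Buss 1986, §2.5).
[cite: Buss1986, §2.5] -/
def pairF : PVFun 3 := ap₂ add (ap₂ sh (proj 0) (proj 2)) (proj 1)

/-- `pairF` on `ℕ`. [cite: Buss1986, §2.5] -/
@[simp] theorem eval_pairF (v : Fin 3 → ℕ) :
    pairF.eval v = v 0 * 2 ^ Nat.size (v 2) + v 1 := by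
  simp [pairF]

end PVFun

namespace PV1

open PVFun

variable {M : Type} [Language.pv.Structure M] [hB : M ⊨ BASIC]

/-! ## Small algebra in a model of `BASIC` -/

/-- `w · (2u) = 2 (w u)` (no associativity needed). [folklore] -/
theorem mul_two_mul' (w u : M) : w * (2 * u) = 2 * (w * u) := by
  rw [two_mul, two_mul, left_distrib]

/-- `(2x) · u = 2 (x u)`. [folklore] -/
theorem two_mul_mul' (x u : M) : 2 * x * u = 2 * (x * u) := by
  rw [two_mul, two_mul, right_distrib]

/-! ## Shifting -/

/-- `sh (w, t) = w · (1 # t)` in `M`. [cite: Buss1986, §2.5] -/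
theorem papp_sh (hD : M ⊨ PVdef) (w t : M) : papp sh ![w, t] = w * mSmash 1 t := by
  rw [sh, papp_ap₂ hD, papp_ap₂ hD, papp_proj hD, papp_proj hD, papp_one' hD, papp_mul,
    papp_smash, mMul_eq]; rfl

/-- `sh (w, 0) = w`. [cite: Buss1986, §2.5] -/
@[simp] theorem sh_zero (hD : M ⊨ PVdef) (w : M) : papp sh ![w, 0] = w := by
  rw [papp_sh hD, mSmash_zero' hD, mul_one]

/-- `sh (w, s_b t) = s₀ (sh (w, t))` for `s_b t ≠ 0`. [cite: Buss1986, §2.5] -/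
theorem sh_pbit (hD : M ⊨ PVdef) (w : M) {b : Bool} {t : M} (ht : pbit b t ≠ 0) :
    papp sh ![w, pbit b t] = pbit false (papp sh ![w, t]) := by
  rw [papp_sh hD, papp_sh hD, one_mSmash_pbit hD b t ht, pbit_false_eq hD, pbit_false_eq hD,
    mul_two_mul']

/-- `sh` is monotone in `w`. [folklore] -/
theorem sh_le_sh (hD : M ⊨ PVdef) {w w' : M} (h : w ≤ w') (t : M) :
    papp sh ![w, t] ≤ papp sh ![w', t] := by
  rw [papp_sh hD, papp_sh hD]; exact mul_le_mul'' h le_rfl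

/-- `sh (w + 1, t) = sh (w, t) + 1 # t`. [folklore] -/
theorem sh_add_one (hD : M ⊨ PVdef) (w t : M) :
    papp sh ![w + 1, t] = papp sh ![w, t] + mSmash 1 t := by
  rw [papp_sh hD, papp_sh hD, right_distrib, one_mul]

/-! ## Low parts and the Euclidean decomposition -/

/-- `low (p, t) ≤ 1 # t`. [cite: Buss1986, §2.5] -/
theorem low_le (hD : M ⊨ PVdef) (p t : M) : papp low ![p, t] ≤ mSmash 1 t := by
  have h := papp_limRec_le hD zero'
    (fun _ => ap₂ add rv (ap₂ mul (ap₁ par (ap₂ mspLen (proj 0) yv)) (ap₂ smash one' yv)))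
    (ap₂ smash one' lastv) ![p] t
  rw [papp_ap₂ hD, papp_one' hD, papp_lastv hD, papp_smash, snoc_vec1'] at h
  exact h

/-- `low (p, 0) = 0`. [cite: Buss1986, §2.5] -/
@[simp] theorem low_zero (hD : M ⊨ PVdef) (p : M) : papp low ![p, 0] = 0 := by
  have h := papp_limRec_zero hD zero'
    (fun _ => ap₂ add rv (ap₂ mul (ap₁ par (ap₂ mspLen (proj 0) yv)) (ap₂ smash one' yv)))
    (ap₂ smash one' lastv) ![p]
  rw [snoc_vec1', papp_zero' hD] at h
  rw [low, h]
  exact min_eq_left bot_le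

/-- `par x ≤ 1`. [cite: Cook1975, §2] -/
theorem par_le_one (hD : M ⊨ PVdef) (x : M) : papp par ![x] ≤ 1 := by
  rcases par_cases hD x with ⟨-, h⟩ | ⟨h, -⟩ | ⟨h, -⟩ <;> rw [h]
  · exact bot_le
  · exact bot_le

/-- The step of `low`: `low (p, s_i t) = low (p, t) + par (mspLen (p, t)) · (1 # t)` for
`s_i t ≠ 0` (no truncation). [cite: Buss1986, §2.5] -/
theorem low_pbit (hD : M ⊨ PVdef) (p : M) {i : Bool} {t : M} (ht : pbit i t ≠ 0) :
    papp low ![p, pbit i t] = papp low ![p, t] + papp par ![msp p t] * mSmash 1 t := by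
  have h := papp_limRec_bit hD i zero'
    (fun _ => ap₂ add rv (ap₂ mul (ap₁ par (ap₂ mspLen (proj 0) yv)) (ap₂ smash one' yv)))
    (ap₂ smash one' lastv) ![p] t ht
  simp only [papp_ap₂ hD, papp_ap₁ hD, papp_rv hD, papp_yv hD, papp_lastv hD, papp_one' hD,
    papp_add, papp_mul, papp_smash, mAdd_eq, mMul_eq, papp_proj hD] at h
  rw [← low, snoc_vec1', snoc_vec1'] at h
  change papp low ![p, pbit i t] =
    min (papp low ![p, t] + papp par ![msp p t] * mSmash 1 t) (mSmash 1 (pbit i t)) at h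
  rw [h]
  refine min_eq_left ?_
  rw [one_mSmash_pbit hD i t ht, pbit_false_eq hD, two_mul]
  refine add_le_add (low_le hD p t) ?_
  calc papp par ![msp p t] * mSmash 1 t ≤ 1 * mSmash 1 t :=
      mul_le_mul'' (par_le_one hD _) le_rfl
    _ = mSmash 1 t := one_mul _

/-- **`low (p, t) < 1 # t`** in every model of `PV₁`. [cite: Buss1986, §2.5] -/
theorem low_lt (hM : M ⊨ PV1) (p t : M) : papp low ![p, t] < mSmash 1 t := by
  have hD := model_PVdef_of_model_PV1 hM
  refine IsQFPVDef.bitInd hM (P := fun t => papp low ![p, t] < mSmash 1 t) ?_ ?_ ?_ t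
  · exact IsQFPVDef.lt' (isPVTermFn_app2 _ (IsPVTermFn.const p) isPVTermFn_v0)
      (IsPVTermFn.one.smash isPVTermFn_v0)
  · rw [low_zero hD, mSmash_zero' hD]; exact zero_lt_one
  · intro i t ht ih
    rw [low_pbit hD p ht, one_mSmash_pbit hD i t ht, pbit_false_eq hD, two_mul]
    calc papp low ![p, t] + papp par ![msp p t] * mSmash 1 t
        < mSmash 1 t + papp par ![msp p t] * mSmash 1 t := add_lt_add_of_lt_of_le ih le_rfl
      _ ≤ mSmash 1 t + 1 * mSmash 1 t :=
        add_le_add le_rfl (mul_le_mul'' (par_le_one hD _) le_rfl)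
      _ = mSmash 1 t + mSmash 1 t := by rw [one_mul]

/-- `x = 2 ⌊x/2⌋ + par x`. [cite: Cook1975, §2] -/
theorem two_mul_mHalf_add_par (hD : M ⊨ PVdef) (x : M) :
    2 * mHalf x + papp par ![x] = x := by
  rcases par_cases hD x with ⟨h0, hp⟩ | ⟨hp, he, -⟩ | ⟨hp, ho⟩
  · rw [hp, h0, mHalf_zero' hD, mul_zero, add_zero]
  · rw [hp, add_zero]; conv_rhs => rw [he, pbit_false_eq hD]
  · rw [hp]; conv_rhs => rw [ho, pbit_true_eq hD]

/-- **The Euclidean decomposition**: `p = sh (mspLen (p, t), t) + low (p, t)` in every model of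
`PV₁` (open `PIND` on `t`). [cite: Buss1986, §2.5] -/
theorem sh_msp_add_low (hM : M ⊨ PV1) (p t : M) :
    papp sh ![msp p t, t] + papp low ![p, t] = p := by
  have hD := model_PVdef_of_model_PV1 hM
  refine IsQFPVDef.bitInd hM (P := fun t => papp sh ![msp p t, t] + papp low ![p, t] = p)
    ?_ ?_ ?_ t
  · exact IsQFPVDef.eq ((isPVTermFn_app2 _ (isPVTermFn_app2 _ (IsPVTermFn.const p)
      isPVTermFn_v0) isPVTermFn_v0).add (isPVTermFn_app2 _ (IsPVTermFn.const p) isPVTermFn_v0))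
      (IsPVTermFn.const p)
  · rw [msp_zero hD, sh_zero hD, low_zero hD, add_zero]
  · intro i t ht ih
    rw [msp_pbit hD p ht, low_pbit hD p ht, papp_sh hD, one_mSmash_pbit hD i t ht,
      pbit_false_eq hD, mul_two_mul', ← two_mul_mul', ← add_assoc, add_comm _ (papp low _),
      add_assoc, ← right_distrib, two_mul_mHalf_add_par hD, add_comm, ← papp_sh hD]
    exact ih

/-- **Uniqueness of the decomposition**: if `sh (w, t) + y = sh (w', t) + y'` with
`y, y' < 1 # t` then `w = w'` (and hence `y = y'`). [cite: Buss1986, §2.5] -/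
theorem sh_add_inj (hD : M ⊨ PVdef) {w w' y y' t : M} (hy : y < mSmash 1 t)
    (hy' : y' < mSmash 1 t) (h : papp sh ![w, t] + y = papp sh ![w', t] + y') :
    w = w' ∧ y = y' := by
  have key : ∀ {a a' b b' : M}, b < mSmash 1 t → papp sh ![a, t] + b = papp sh ![a', t] + b' →
      ¬ a < a' := by
    intro a a' b b' hb e hlt
    have h1 : a + 1 ≤ a' := (add_one_le_iff' _ _).2 hlt
    have h2 : papp sh ![a, t] + mSmash 1 t ≤ papp sh ![a', t] := by
      rw [← sh_add_one hD]; exact sh_le_sh hD h1 t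
    have h3 : papp sh ![a, t] + b < papp sh ![a', t] + b' :=
      calc papp sh ![a, t] + b < papp sh ![a, t] + mSmash 1 t := add_lt_add_of_le_of_lt le_rfl hb
        _ ≤ papp sh ![a', t] := h2
        _ ≤ papp sh ![a', t] + b' := le_add_right'' _ _
    exact absurd e h3.ne
  have hw : w = w' := by
    rcases lt_trichotomy w w' with hlt | heq | hgt
    · exact absurd hlt (key hy h)
    · exact heq
    · exact absurd hgt (key hy' h.symm)
  subst hw
  exact ⟨rfl, add_left_cancel h⟩

/-- **`mspLen` of a pair**: `mspLen (sh (w, t) + y, t) = w` for `y < 1 # t`. [cite: Buss1986, §2.5] -/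
theorem msp_sh_add (hM : M ⊨ PV1) (w t : M) {y : M} (hy : y < mSmash 1 t) :
    msp (papp sh ![w, t] + y) t = w := by
  have hD := model_PVdef_of_model_PV1 hM
  have e := sh_msp_add_low hM (papp sh ![w, t] + y) t
  exact (sh_add_inj hD (low_lt hM _ t) hy e).1

/-- **`low` of a pair**: `low (sh (w, t) + y, t) = y` for `y < 1 # t`. [cite: Buss1986, §2.5] -/
theorem low_sh_add (hM : M ⊨ PV1) (w t : M) {y : M} (hy : y < mSmash 1 t) :
    papp low ![papp sh ![w, t] + y, t] = y := by
  have hD := model_PVdef_of_model_PV1 hM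
  have e := sh_msp_add_low hM (papp sh ![w, t] + y) t
  exact (sh_add_inj hD (low_lt hM _ t) hy e).2

/-! ## Pairing -/

/-- `pairF (w, y, t) = sh (w, t) + y` in `M`. [cite: Buss1986, §2.5] -/
theorem papp_pairF (hD : M ⊨ PVdef) (w y t : M) :
    papp pairF ![w, y, t] = papp sh ![w, t] + y := by
  rw [pairF, papp_ap₂ hD, papp_ap₂ hD, papp_proj hD, papp_proj hD, papp_proj hD, papp_add,
    mAdd_eq]; rfl

/-- **First projection of a pair**: `mspLen (⟨w, y⟩_t, t) = w` for `y ≤ t`. [cite: Buss1986, §2.5] -/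
theorem msp_pair (hM : M ⊨ PV1) (w : M) {y t : M} (hy : y ≤ t) :
    msp (papp pairF ![w, y, t]) t = w := by
  rw [papp_pairF (model_PVdef_of_model_PV1 hM)]
  exact msp_sh_add hM w t (lt_one_mSmash_of_le hM hy)

/-- **Second projection of a pair**: `low (⟨w, y⟩_t, t) = y` for `y ≤ t`. [cite: Buss1986, §2.5] -/
theorem low_pair (hM : M ⊨ PV1) (w : M) {y t : M} (hy : y ≤ t) :
    papp low ![papp pairF ![w, y, t], t] = y := by
  rw [papp_pairF (model_PVdef_of_model_PV1 hM)]
  exact low_sh_add hM w t (lt_one_mSmash_of_le hM hy)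

/-- **Bound on pairs**: `⟨w, y⟩_t ≤ sh (W, t) + t` for `w ≤ W`, `y ≤ t`. [cite: Buss1986, §2.5] -/
theorem pairF_le (hD : M ⊨ PVdef) {w W y t : M} (hw : w ≤ W) (hy : y ≤ t) :
    papp pairF ![w, y, t] ≤ papp sh ![W, t] + t := by
  rw [papp_pairF hD]; exact add_le_add (sh_le_sh hD hw t) hy

/-- A pair is below `1 # t · (W + 1)`-ish: precisely `⟨w, y⟩_t < sh (W + 1, t)` for `w ≤ W`,
`y ≤ t`. [cite: Buss1986, §2.5] -/
theorem pairF_lt_sh_succ (hM : M ⊨ PV1) {w W y t : M} (hw : w ≤ W) (hy : y ≤ t) :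
    papp pairF ![w, y, t] < papp sh ![W + 1, t] := by
  have hD := model_PVdef_of_model_PV1 hM
  rw [papp_pairF hD, sh_add_one hD]
  calc papp sh ![w, t] + y ≤ papp sh ![W, t] + y := add_le_add (sh_le_sh hD hw t) le_rfl
    _ < papp sh ![W, t] + mSmash 1 t := add_lt_add_of_le_of_lt le_rfl (lt_one_mSmash_of_le hM hy)

/-! ## Sharply bounded search -/

section LSearch

variable {p : ℕ}

/-- `lsearch G (ȳ, u) ≤ |u| + 1` in every model of `PVdef + BASIC`. [cite: Buss1986, §6.1] -/
theorem lsearch_le (hD : M ⊨ PVdef) (G : PVFun (p + 1)) (ys : Fin p → M) (u : M) :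
    papp (lsearch G) (Fin.snoc ys u) ≤ mLen u + 1 := by
  have h := papp_limRec_le hD (ap₃ cond (appLast G zero') zero' one')
    (fun j => PVFun.selT rv (ap₁ len yv) rv
      (ap₃ cond (appWith G (ap₁ len (ap₁ (bit j) yv))) (ap₁ len (ap₁ (bit j) yv))
        (ap₁ succ (ap₁ len (ap₁ (bit j) yv)))))
    (ap₁ succ (ap₁ len lastv)) ys u
  rwa [papp_ap₁ hD, papp_ap₁ hD, papp_lastv hD, papp_len, papp_succ, mSucc_eq] at h

/-- `lsearch G (ȳ, 0) = cond (G(ȳ, 0), 0, 1)`. [cite: Buss1986, §6.1] -/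
theorem lsearch_zero (hD : M ⊨ PVdef) (G : PVFun (p + 1)) (ys : Fin p → M) :
    papp (lsearch G) (Fin.snoc ys 0) = pcond (papp G (Fin.snoc ys 0)) 0 1 := by
  have h := papp_limRec_zero hD (ap₃ cond (appLast G zero') zero' one')
    (fun j => PVFun.selT rv (ap₁ len yv) rv
      (ap₃ cond (appWith G (ap₁ len (ap₁ (bit j) yv))) (ap₁ len (ap₁ (bit j) yv))
        (ap₁ succ (ap₁ len (ap₁ (bit j) yv)))))
    (ap₁ succ (ap₁ len lastv)) ys
  rw [papp_ap₁ hD, papp_ap₁ hD, papp_lastv hD, papp_len, papp_succ, mSucc_eq, papp_ap₃ hD,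
    papp_appLast hD, papp_zero' hD, papp_one' hD, (mLen_eq_zero_iff (0 : M)).2 rfl,
    zero_add] at h
  rw [lsearch, h]
  refine min_eq_left ?_
  show pcond _ 0 1 ≤ 1
  rcases pcond_eq_or hD (papp G (Fin.snoc ys 0)) (0 : M) 1 with e | e <;> rw [e]
  exact bot_le

/-- `selT` of `PVPrograms` in a model of `PV₁`: definition by cases. [cite: Cook1975, §2] -/
theorem papp_selT (hM : M ⊨ PV1) {n : ℕ} (t u w z : PVFun n) (xs : Fin n → M) :
    papp (PVFun.selT t u w z) xs = if papp t xs ≤ papp u xs then papp w xs else papp z xs := by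
  have hD := model_PVdef_of_model_PV1 hM
  rw [PVFun.selT, papp_comp hD]
  have e : (fun i => papp ((![t, u, w, z] : Fin 4 → PVFun n) i) xs) =
      ![papp t xs, papp u xs, papp w xs, papp z xs] := by
    funext i; fin_cases i <;> rfl
  rw [e, papp_sel hM]

/-- The step of `lsearch`: for `s_j y ≠ 0`, with `r = lsearch G (ȳ, y)` and `ℓ = |s_j y|`,
`lsearch G (ȳ, s_j y) = if r ≤ |y| then r else cond (G(ȳ, ℓ), ℓ, ℓ + 1)`.
[cite: Buss1986, §6.1] -/
theorem lsearch_pbit (hM : M ⊨ PV1) (G : PVFun (p + 1)) (ys : Fin p → M) {j : Bool} {y : M}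
    (hy : pbit j y ≠ 0) :
    papp (lsearch G) (Fin.snoc ys (pbit j y)) =
      if papp (lsearch G) (Fin.snoc ys y) ≤ mLen y then papp (lsearch G) (Fin.snoc ys y)
      else pcond (papp G (Fin.snoc ys (mLen (pbit j y)))) (mLen (pbit j y))
        (mLen (pbit j y) + 1) := by
  have hD := model_PVdef_of_model_PV1 hM
  have h := papp_limRec_bit hD j (ap₃ cond (appLast G zero') zero' one')
    (fun j => PVFun.selT rv (ap₁ len yv) rv
      (ap₃ cond (appWith G (ap₁ len (ap₁ (bit j) yv))) (ap₁ len (ap₁ (bit j) yv))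
        (ap₁ succ (ap₁ len (ap₁ (bit j) yv)))))
    (ap₁ succ (ap₁ len lastv)) ys y hy
  rw [papp_ap₁ hD, papp_ap₁ hD, papp_lastv hD, papp_len, papp_succ, mSucc_eq] at h
  rw [lsearch, h, ← lsearch]
  rw [papp_selT hM]
  simp only [papp_ap₃ hD, papp_ap₁ hD, papp_rv hD, papp_yv hD, papp_appWith hD, papp_len,
    papp_succ, mSucc_eq]
  change min (if papp (lsearch G) (Fin.snoc ys y) ≤ mLen y then papp (lsearch G) (Fin.snoc ys y)
    else pcond (papp G (Fin.snoc ys (mLen (pbit j y)))) (mLen (pbit j y)) (mLen (pbit j y) + 1))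
    (mLen (pbit j y) + 1) = _
  refine min_eq_left ?_
  split_ifs with hle
  · rw [mLen_pbit hD hy]; exact hle.trans ((le_add_right'' _ _).trans (le_add_right'' _ _))
  · rcases pcond_eq_or hD (papp G (Fin.snoc ys (mLen (pbit j y)))) (mLen (pbit j y))
      (mLen (pbit j y) + 1) with e | e <;> rw [e]
    exact le_add_right'' _ _

/-- **No zero below the search value**: if `i < lsearch G (ȳ, u)` then `G(ȳ, i) ≠ 0`, in every
model of `PV₁` (open `PIND` on `u`). [cite: Buss1986, §6.1] -/
theorem ne_zero_of_lt_lsearch (hM : M ⊨ PV1) (G : PVFun (p + 1)) (ys : Fin p → M) (u : M)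
    {i : M} (hi : i < papp (lsearch G) (Fin.snoc ys u)) : papp G (Fin.snoc ys i) ≠ 0 := by
  have hD := model_PVdef_of_model_PV1 hM
  revert hi
  refine IsQFPVDef.bitInd hM
    (P := fun u => i < papp (lsearch G) (Fin.snoc ys u) → papp G (Fin.snoc ys i) ≠ 0) ?_ ?_ ?_ u
  · exact IsQFPVDef.imp (IsQFPVDef.lt' (IsPVTermFn.const i) (isPVTermFn_app_snoc1 _ ys
      isPVTermFn_v0)) (IsQFPVDef.ne' (IsPVTermFn.const _) IsPVTermFn.zero)
  · intro hi
    rw [lsearch_zero hD] at hi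
    by_cases h0 : papp G (Fin.snoc ys 0) = 0
    · rw [h0, pcond_zero hD] at hi; exact absurd hi bot_le.not_gt
    · rw [pcond_of_ne_zero hD h0] at hi
      have : i = 0 := le_antisymm ((lt_add_one_iff' i 0).1 (by rwa [zero_add])) bot_le
      rwa [this]
  · intro j y hy ih hi
    rw [lsearch_pbit hM G ys hy] at hi
    split_ifs at hi with hle
    · exact ih hi
    · rw [not_le] at hle
      have hr : papp (lsearch G) (Fin.snoc ys y) = mLen y + 1 :=
        le_antisymm (lsearch_le hD G ys y) ((add_one_le_iff' _ _).2 hle)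
      have hℓ : mLen (pbit j y) = mLen y + 1 := mLen_pbit hD hy
      by_cases hG : papp G (Fin.snoc ys (mLen (pbit j y))) = 0
      · rw [hG, pcond_zero hD, hℓ, ← hr] at hi; exact ih hi
      · rw [pcond_of_ne_zero hD hG, lt_add_one_iff', le_iff_lt_or_eq] at hi
        rcases hi with hi | hi
        · rw [hℓ, ← hr] at hi; exact ih hi
        · rw [hi]; exact hG

/-- **A zero at the search value**: if `lsearch G (ȳ, u) ≤ |u|` then `G(ȳ, lsearch G (ȳ,u)) = 0`,
in every model of `PV₁` (open `PIND` on `u`). [cite: Buss1986, §6.1] -/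
theorem eq_zero_of_lsearch_le (hM : M ⊨ PV1) (G : PVFun (p + 1)) (ys : Fin p → M) (u : M)
    (h : papp (lsearch G) (Fin.snoc ys u) ≤ mLen u) :
    papp G (Fin.snoc ys (papp (lsearch G) (Fin.snoc ys u))) = 0 := by
  have hD := model_PVdef_of_model_PV1 hM
  revert h
  refine IsQFPVDef.bitInd hM
    (P := fun u => papp (lsearch G) (Fin.snoc ys u) ≤ mLen u →
      papp G (Fin.snoc ys (papp (lsearch G) (Fin.snoc ys u))) = 0) ?_ ?_ ?_ u
  · have hL : IsPVTermFn fun v : Fin 1 → M => papp (lsearch G) (Fin.snoc ys (v 0)) :=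
      isPVTermFn_app_snoc1 _ ys isPVTermFn_v0
    exact IsQFPVDef.imp (IsQFPVDef.le' hL isPVTermFn_v0.len)
      (IsQFPVDef.eq (isPVTermFn_app_snoc1 _ ys hL) IsPVTermFn.zero)
  · intro h
    rw [lsearch_zero hD] at h ⊢
    by_cases h0 : papp G (Fin.snoc ys 0) = 0
    · rwa [h0, pcond_zero hD]
    · rw [pcond_of_ne_zero hD h0, (mLen_eq_zero_iff (0 : M)).2 rfl] at h
      exact absurd h (not_le.2 zero_lt_one)
  · intro j y hy ih h
    rw [lsearch_pbit hM G ys hy] at h ⊢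
    split_ifs at h ⊢ with hle
    · exact ih hle
    · by_cases hG : papp G (Fin.snoc ys (mLen (pbit j y))) = 0
      · rwa [hG, pcond_zero hD]
      · rw [pcond_of_ne_zero hD hG] at h
        exact absurd h (lt_add_one' _).not_ge

/-- **Sharply bounded search decides sharply bounded existence** in every model of `PV₁`:
`(∃ i ≤ |u|, G(ȳ, i) = 0) ↔ lsearch G (ȳ, u) ≤ |u|`. [cite: Buss1986, §6.1] -/
theorem exists_le_len_iff_lsearch_le (hM : M ⊨ PV1) (G : PVFun (p + 1)) (ys : Fin p → M)
    (u : M) : (∃ i, i ≤ mLen u ∧ papp G (Fin.snoc ys i) = 0) ↔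
      papp (lsearch G) (Fin.snoc ys u) ≤ mLen u := by
  constructor
  · rintro ⟨i, hi, hG⟩
    by_contra hlt
    rw [not_le] at hlt
    exact ne_zero_of_lt_lsearch hM G ys u (hi.trans_lt hlt) hG
  · intro h
    exact ⟨_, h, eq_zero_of_lsearch_le hM G ys u h⟩

end LSearch

end PV1


/-! # Part III. Tables -/

namespace PVFun

variable {q : ℕ}

/-- The truncated entry `e(c̄, B, z) = min (G(c̄, z), B)` as a symbol of `(c̄, B, z)`. [folklore] -/
def entryVal (G : PVFun (q + 1)) : PVFun (q + 2) :=
  minT (comp G (Fin.snoc (fun i => proj (Fin.castSucc (Fin.castSucc i))) (proj (Fin.last (q + 1)))))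
    (proj (Fin.castSucc (Fin.last q)))

/-- **The table of a symbol**: `tbl' G (c̄, B, s)` codes `min (G(c̄, z), B)` for `z = 0, …, |s|`
in blocks of `|B|` bits, most recent entry lowest: `T(0) = e(0)`,
`T(s_j s') = sh (T(s'), B) + e(|s_j s'|)`, bound `(s₁ s) # B` (Buss 1986, §2.5).
[cite: Buss1986, §2.5] -/
def tbl' (G : PVFun (q + 1)) : PVFun (q + 2) :=
  limRec
    (comp (entryVal G) (Fin.snoc (fun i => proj i) zero'))
    (fun j => ap₃ pairF rv
      (comp (entryVal G) (Fin.snoc (fun i => proj (Fin.castSucc (Fin.castSucc i)))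
        (ap₁ len (ap₁ (bit j) yv))))
      (proj (Fin.castSucc (Fin.castSucc (Fin.last q)))))
    (ap₂ smash (ap₁ (bit true) lastv) (proj (Fin.castSucc (Fin.last q))))

/-- **Dropping blocks**: `drop (W, z, B, s)` is `W` shifted right by `|B| · (|s| ∸ z)` bits:
`drop (W,z,B,0) = W`, `drop (W,z,B,s_j s') = W` if `|s_j s'| ≤ z` and `= mspLen (drop (…,s'), B)`
otherwise; bound `W`. [cite: Buss1986, §2.5] -/
def drop : PVFun 4 :=
  limRec (proj 0)
    (fun j => selT (ap₁ len (ap₁ (bit j) (proj 3))) (proj 1) (proj 0) (ap₂ mspLen rv (proj 2)))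
    (proj 0)

/-- **Decoding a table**: `entry' (W, z, B, s) = low (drop (W, z, B, s), B)`, the entry of index
`z` of a table of `|s| + 1` blocks of width `|B|`. [cite: Buss1986, §2.5] -/
def entry' : PVFun 4 := ap₂ low drop (proj 2)

end PVFun

namespace PV1

open PVFun

variable {M : Type} [Language.pv.Structure M] [hB : M ⊨ BASIC] {q : ℕ}

/-! ## Entries -/

/-- `low (x, B) = x` for `x ≤ B`. [cite: Buss1986, §2.5] -/
theorem low_eq_self_of_le (hM : M ⊨ PV1) {x B : M} (h : x ≤ B) : papp low ![x, B] = x := by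
  have hD := model_PVdef_of_model_PV1 hM
  have e := sh_msp_add_low hM x B
  have h0 : msp x B = 0 := (msp_eq_zero_iff hM x B).2 (mLen_le_mLen h)
  rwa [h0, papp_sh hD, zero_mul, zero_add] at e

/-- `minT` in a model of `PV₁` is `min`. [cite: Cook1975, §2] -/
theorem papp_minT (hM : M ⊨ PV1) {n : ℕ} (t u : PVFun n) (xs : Fin n → M) :
    papp (minT t u) xs = min (papp t xs) (papp u xs) := by
  rw [minT, papp_selT hM]
  split_ifs with h
  · exact (min_eq_left h).symm
  · exact (min_eq_right (not_le.1 h).le).symm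

/-- The truncated entry in `M`: `entryVal G (c̄, B, z) = min (G(c̄, z), B)`. [folklore] -/
theorem papp_entryVal (hM : M ⊨ PV1) (G : PVFun (q + 1)) (c : Fin q → M) (B z : M) :
    papp (entryVal G) (Fin.snoc (Fin.snoc c B) z) = min (papp G (Fin.snoc c z)) B := by
  have hD := model_PVdef_of_model_PV1 hM
  rw [entryVal, papp_minT hM, papp_comp hD, papp_proj hD]
  congr 1
  · congr 1; funext i
    cases i using Fin.lastCases with
    | last => simp [papp_proj hD]
    | cast i => simp [papp_proj hD]
  · simp

/-- Truncated entries are `≤ B`. [folklore] -/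
theorem entryVal_le (hM : M ⊨ PV1) (G : PVFun (q + 1)) (c : Fin q → M) (B z : M) :
    papp (entryVal G) (Fin.snoc (Fin.snoc c B) z) ≤ B := by
  rw [papp_entryVal hM]; exact min_le_right _ _

/-! ## The table: recursion equations and the size invariant -/

omit hB in
/-- The size bound `k(s) = (s₁ s) # B` of the table. [folklore] -/
theorem papp_tblBound (hD : M ⊨ PVdef) (c : Fin q → M) (B s : M) :
    papp (ap₂ smash (ap₁ (bit true) lastv) (proj (Fin.castSucc (Fin.last q))) : PVFun (q + 2))
      (Fin.snoc (Fin.snoc c B) s) = mSmash (pbit true s) B := by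
  rw [papp_ap₂ hD, papp_ap₁ hD, papp_lastv hD, papp_proj hD, papp_smash]
  simp

/-- The step of the size bound: `(s₁ (s_j s')) # B = ((s₁ s') # B) · (1 # B)`. [cite: Buss1986, §2.2] -/
theorem mSmash_pbit_true_pbit (hD : M ⊨ PVdef) {j : Bool} {s : M} (hs : pbit j s ≠ 0) (B : M) :
    mSmash (pbit true (pbit j s)) B = mSmash (pbit true s) B * mSmash 1 B := by
  refine mSmash_eq_mul_of_mLen_eq_add ?_ B
  rw [mLen_pbit hD (pbit_true_ne_zero hD _), mLen_pbit hD hs, mLen_pbit hD (pbit_true_ne_zero hD _),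
    mLen_one]

/-- `T(c̄, B, 0) = min (G(c̄, 0), B)`. [cite: Buss1986, §2.5] -/
theorem tbl'_zero (hM : M ⊨ PV1) (G : PVFun (q + 1)) (c : Fin q → M) (B : M) :
    papp (tbl' G) (Fin.snoc (Fin.snoc c B) 0) = min (papp G (Fin.snoc c 0)) B := by
  have hD := model_PVdef_of_model_PV1 hM
  rw [tbl', papp_limRec_zero hD, papp_tblBound hD]
  have e : papp (comp (entryVal G) (Fin.snoc (fun i => proj i) zero')) (Fin.snoc c B) =
      papp (entryVal G) (Fin.snoc (Fin.snoc c B) 0) := by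
    rw [papp_comp hD]; congr 1; funext i
    cases i using Fin.lastCases with
    | last => simp [papp_zero' hD]
    | cast i => simp [papp_proj hD]
  rw [e, papp_entryVal hM]
  refine min_eq_left ((min_le_right _ _).trans ?_)
  calc B ≤ mSmash 1 B := (lt_one_mSmash hM B).le
    _ = mSmash (pbit true 0) B := by rw [← one_eq_pbit hD]

/-- The raw step of the table (with truncation). [folklore] -/
private theorem tbl'_pbit_min (hM : M ⊨ PV1) (G : PVFun (q + 1)) (c : Fin q → M) (B : M)
    {j : Bool} {s : M} (hs : pbit j s ≠ 0) :
    papp (tbl' G) (Fin.snoc (Fin.snoc c B) (pbit j s)) =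
      min (papp pairF ![papp (tbl' G) (Fin.snoc (Fin.snoc c B) s),
          min (papp G (Fin.snoc c (mLen (pbit j s)))) B, B])
        (mSmash (pbit true (pbit j s)) B) := by
  have hD := model_PVdef_of_model_PV1 hM
  rw [tbl', papp_limRec_bit hD j _ _ _ _ _ hs, ← tbl', papp_tblBound hD, papp_ap₃ hD, papp_rv hD]
  congr 2
  have eB : papp (proj (Fin.castSucc (Fin.castSucc (Fin.last q))) : PVFun (q + 3))
      (Fin.snoc (Fin.snoc (Fin.snoc c B) s) (papp (tbl' G) (Fin.snoc (Fin.snoc c B) s))) = B := by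
    rw [papp_proj hD]; simp
  have eE : papp (comp (entryVal G) (Fin.snoc (fun i => proj (Fin.castSucc (Fin.castSucc i)))
      (ap₁ len (ap₁ (bit j) yv))) : PVFun (q + 3))
      (Fin.snoc (Fin.snoc (Fin.snoc c B) s) (papp (tbl' G) (Fin.snoc (Fin.snoc c B) s))) =
      papp (entryVal G) (Fin.snoc (Fin.snoc c B) (mLen (pbit j s))) := by
    rw [papp_comp hD]; congr 1; funext i
    cases i using Fin.lastCases with
    | last => simp [papp_ap₁ hD, papp_yv hD, papp_len]
    | cast i => simp [papp_proj hD]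
  rw [eB, eE, papp_entryVal hM]

/-- **The size invariant and the step equation of the table** in every model of `PV₁`:
`T(c̄, B, s) < (s₁ s) # B` (open `PIND` on `s`). [cite: Buss1986, §2.5] -/
theorem tbl'_lt (hM : M ⊨ PV1) (G : PVFun (q + 1)) (c : Fin q → M) (B s : M) :
    papp (tbl' G) (Fin.snoc (Fin.snoc c B) s) < mSmash (pbit true s) B := by
  have hD := model_PVdef_of_model_PV1 hM
  refine IsQFPVDef.bitInd hM
    (P := fun s => papp (tbl' G) (Fin.snoc (Fin.snoc c B) s) < mSmash (pbit true s) B) ?_ ?_ ?_ s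
  · exact IsQFPVDef.lt' (isPVTermFn_app_snoc1 _ _ isPVTermFn_v0)
      ((isPVTermFn_v0.bit true).smash (IsPVTermFn.const B))
  · rw [tbl'_zero hM]
    calc min (papp G (Fin.snoc c 0)) B ≤ B := min_le_right _ _
      _ < mSmash 1 B := lt_one_mSmash hM B
      _ = mSmash (pbit true 0) B := by rw [← one_eq_pbit hD]
  · intro j s hs ih
    have hlt : papp pairF ![papp (tbl' G) (Fin.snoc (Fin.snoc c B) s),
        min (papp G (Fin.snoc c (mLen (pbit j s)))) B, B] < mSmash (pbit true (pbit j s)) B := by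
      rw [mSmash_pbit_true_pbit hD hs]
      calc papp pairF ![papp (tbl' G) (Fin.snoc (Fin.snoc c B) s),
            min (papp G (Fin.snoc c (mLen (pbit j s)))) B, B]
          < papp sh ![papp (tbl' G) (Fin.snoc (Fin.snoc c B) s) + 1, B] :=
            pairF_lt_sh_succ hM le_rfl (min_le_right _ _)
        _ ≤ mSmash (pbit true s) B * mSmash 1 B := by
            rw [papp_sh hD]; exact mul_le_mul'' ((add_one_le_iff' _ _).2 ih) le_rfl
    rw [tbl'_pbit_min hM G c B hs, min_eq_left hlt.le]
    exact hlt

/-- **The step of the table without truncation**: for `s_j s ≠ 0`,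
`T(c̄, B, s_j s) = ⟨T(c̄, B, s), min (G(c̄, |s_j s|), B)⟩_B`. [cite: Buss1986, §2.5] -/
theorem tbl'_pbit (hM : M ⊨ PV1) (G : PVFun (q + 1)) (c : Fin q → M) (B : M)
    {j : Bool} {s : M} (hs : pbit j s ≠ 0) :
    papp (tbl' G) (Fin.snoc (Fin.snoc c B) (pbit j s)) =
      papp pairF ![papp (tbl' G) (Fin.snoc (Fin.snoc c B) s),
        min (papp G (Fin.snoc c (mLen (pbit j s)))) B, B] := by
  have h := tbl'_lt hM G c B (pbit j s)
  rw [tbl'_pbit_min hM G c B hs] at h ⊢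
  by_contra hne
  rw [min_def] at h hne
  split_ifs at h hne with hle
  · exact hne rfl
  · exact lt_irrefl _ h

/-- Projections of the table step: `mspLen (T(s_j s), B) = T(s)` and
`low (T(s_j s), B) = min (G(c̄, |s_j s|), B)`. [cite: Buss1986, §2.5] -/
theorem msp_tbl'_pbit (hM : M ⊨ PV1) (G : PVFun (q + 1)) (c : Fin q → M) (B : M)
    {j : Bool} {s : M} (hs : pbit j s ≠ 0) :
    msp (papp (tbl' G) (Fin.snoc (Fin.snoc c B) (pbit j s))) B =
        papp (tbl' G) (Fin.snoc (Fin.snoc c B) s) ∧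
      papp low ![papp (tbl' G) (Fin.snoc (Fin.snoc c B) (pbit j s)), B] =
        min (papp G (Fin.snoc c (mLen (pbit j s)))) B := by
  rw [tbl'_pbit hM G c B hs]
  exact ⟨msp_pair hM _ (min_le_right _ _), low_pair hM _ (min_le_right _ _)⟩

/-! ## Dropping blocks and decoding -/

omit [Language.pv.Structure M] hB in
/-- Coordinate `0` of the recursion context `(W, z, B, s, r)`. [folklore] -/
@[simp] theorem snoc5_0 (W z B s r : M) :
    (Fin.snoc (Fin.snoc ![W, z, B] s) r : Fin 5 → M) 0 = W := rfl

omit [Language.pv.Structure M] hB in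
/-- Coordinate `1` of the recursion context `(W, z, B, s, r)`. [folklore] -/
@[simp] theorem snoc5_1 (W z B s r : M) :
    (Fin.snoc (Fin.snoc ![W, z, B] s) r : Fin 5 → M) 1 = z := rfl

omit [Language.pv.Structure M] hB in
/-- Coordinate `2` of the recursion context `(W, z, B, s, r)`. [folklore] -/
@[simp] theorem snoc5_2 (W z B s r : M) :
    (Fin.snoc (Fin.snoc ![W, z, B] s) r : Fin 5 → M) 2 = B := rfl

omit [Language.pv.Structure M] hB in
/-- Coordinate `3` of the recursion context `(W, z, B, s, r)`. [folklore] -/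
@[simp] theorem snoc5_3 (W z B s r : M) :
    (Fin.snoc (Fin.snoc ![W, z, B] s) r : Fin 5 → M) 3 = s := rfl

/-- `drop (W, z, B, s) ≤ W`. [folklore] -/
theorem drop_le (hD : M ⊨ PVdef) (W z B s : M) : papp drop ![W, z, B, s] ≤ W := by
  have h := papp_limRec_le hD (proj 0)
    (fun j => PVFun.selT (ap₁ len (ap₁ (bit j) (proj 3))) (proj 1) (proj 0)
      (ap₂ mspLen rv (proj 2))) (proj 0) ![W, z, B] s
  rw [papp_proj hD, snoc_vec3'] at h
  exact h

/-- `drop (W, z, B, 0) = W`. [folklore] -/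
theorem drop_zero (hD : M ⊨ PVdef) (W z B : M) : papp drop ![W, z, B, 0] = W := by
  have h := papp_limRec_zero hD (proj 0)
    (fun j => PVFun.selT (ap₁ len (ap₁ (bit j) (proj 3))) (proj 1) (proj 0)
      (ap₂ mspLen rv (proj 2))) (proj 0) ![W, z, B]
  rw [papp_proj hD, papp_proj hD, snoc_vec3'] at h
  rw [drop, h]
  exact min_eq_left le_rfl

/-- The step of `drop`: for `s_j s ≠ 0`, `drop (W, z, B, s_j s) = W` if `|s_j s| ≤ z`, and
`= mspLen (drop (W, z, B, s), B)` otherwise. [folklore] -/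
theorem drop_pbit (hM : M ⊨ PV1) (W z B : M) {j : Bool} {s : M} (hs : pbit j s ≠ 0) :
    papp drop ![W, z, B, pbit j s] =
      if mLen (pbit j s) ≤ z then W else msp (papp drop ![W, z, B, s]) B := by
  have hD := model_PVdef_of_model_PV1 hM
  have h := papp_limRec_bit hD j (proj 0)
    (fun j => PVFun.selT (ap₁ len (ap₁ (bit j) (proj 3))) (proj 1) (proj 0)
      (ap₂ mspLen rv (proj 2))) (proj 0) ![W, z, B] s hs
  rw [papp_proj hD, papp_selT hM, ← drop] at h
  simp only [papp_ap₁ hD, papp_ap₂ hD, papp_proj hD, papp_rv hD, papp_len, snoc5_0, snoc5_1,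
    snoc5_2, snoc5_3] at h
  rw [snoc_vec3', snoc_vec3'] at h
  change papp drop ![W, z, B, pbit j s] =
    min (if mLen (pbit j s) ≤ z then W else msp (papp drop ![W, z, B, s]) B)
      ((![W, z, B, pbit j s] : Fin 4 → M) 0) at h
  rw [h]
  change min _ W = _
  refine min_eq_left ?_
  split_ifs
  · exact le_rfl
  · exact (msp_le hD _ _).trans (drop_le hD W z B s)

/-- **The shift lemma**: `mspLen (drop (W, z, B, s), B) = drop (mspLen (W, B), z, B, s)`
(open `PIND` on `s`). [folklore] -/
theorem msp_drop (hM : M ⊨ PV1) (W z B s : M) :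
    msp (papp drop ![W, z, B, s]) B = papp drop ![msp W B, z, B, s] := by
  have hD := model_PVdef_of_model_PV1 hM
  refine IsQFPVDef.bitInd hM
    (P := fun s => msp (papp drop ![W, z, B, s]) B = papp drop ![msp W B, z, B, s]) ?_ ?_ ?_ s
  · refine IsQFPVDef.eq (isPVTermFn_app2 _ ?_ (IsPVTermFn.const B)) ?_
    · exact (IsPVTermFn.app drop (F := ![fun _ => W, fun _ => z, fun _ => B, fun v => v 0])
        fun i => by fin_cases i <;> first | exact IsPVTermFn.const _ | exact isPVTermFn_v0).of_eq
        fun v => by congr 1; funext i; fin_cases i <;> rfl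
    · exact (IsPVTermFn.app drop (F := ![fun _ => msp W B, fun _ => z, fun _ => B, fun v => v 0])
        fun i => by fin_cases i <;> first | exact IsPVTermFn.const _ | exact isPVTermFn_v0).of_eq
        fun v => by congr 1; funext i; fin_cases i <;> rfl
  · rw [drop_zero hD, drop_zero hD]
  · intro j s hs ih
    rw [drop_pbit hM W z B hs, drop_pbit hM (msp W B) z B hs]
    split_ifs
    · rfl
    · rw [ih]

/-- **Decoding the table**: for `z ≤ |s|`, `entry' (T(c̄, B, s), z, B, s) = min (G(c̄, z), B)`,
in every model of `PV₁` (open `PIND` on `s`, using the shift lemma and the projections of the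
table step). [cite: Buss1986, §2.5] -/
theorem entry'_tbl' (hM : M ⊨ PV1) (G : PVFun (q + 1)) (c : Fin q → M) (B s : M) {z : M}
    (hz : z ≤ mLen s) :
    papp entry' ![papp (tbl' G) (Fin.snoc (Fin.snoc c B) s), z, B, s] =
      min (papp G (Fin.snoc c z)) B := by
  have hD := model_PVdef_of_model_PV1 hM
  have hentry : ∀ W s' : M, papp entry' ![W, z, B, s'] = papp low ![papp drop ![W, z, B, s'], B] := by
    intro W s'
    rw [entry', papp_ap₂ hD, papp_proj hD]; rfl
  revert hz
  refine IsQFPVDef.bitInd hM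
    (P := fun s => z ≤ mLen s → papp entry' ![papp (tbl' G) (Fin.snoc (Fin.snoc c B) s), z, B, s] =
      min (papp G (Fin.snoc c z)) B) ?_ ?_ ?_ s
  · refine IsQFPVDef.imp (IsQFPVDef.le' (IsPVTermFn.const z) isPVTermFn_v0.len)
      (IsQFPVDef.eq ?_ (IsPVTermFn.const _))
    exact (IsPVTermFn.app entry' (F := ![fun v => papp (tbl' G) (Fin.snoc (Fin.snoc c B) (v 0)),
      fun _ => z, fun _ => B, fun v => v 0]) fun i => by
        fin_cases i
        · exact isPVTermFn_app_snoc1 _ _ isPVTermFn_v0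
        · exact IsPVTermFn.const _
        · exact IsPVTermFn.const _
        · exact isPVTermFn_v0).of_eq
      fun v => by congr 1; funext i; fin_cases i <;> rfl
  · intro hz
    rw [(mLen_eq_zero_iff (0 : M)).2 rfl] at hz
    have hz0 : z = 0 := le_antisymm hz bot_le
    subst hz0
    rw [hentry, drop_zero hD, tbl'_zero hM, low_eq_self_of_le hM (min_le_right _ _)]
  · intro j s hs ih hz
    rw [hentry, drop_pbit hM _ z B hs]
    split_ifs with hle
    · have hz' : z = mLen (pbit j s) := le_antisymm hz hle
      rw [(msp_tbl'_pbit hM G c B hs).2, hz']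
    · rw [not_le, mLen_pbit hD hs, lt_add_one_iff'] at hle
      rw [msp_drop hM, (msp_tbl'_pbit hM G c B hs).1, ← hentry]
      exact ih hle

/-- **Tables below a bound**: `T(c̄, B, s) < (s₁ s) # B` and all its entries of index `≤ |s|`
are the truncated values (summary form used by the collection argument). [cite: Buss1986, §2.5] -/
theorem exists_table (hM : M ⊨ PV1) (G : PVFun (q + 1)) (c : Fin q → M) (B s : M)
    (hG : ∀ z, z ≤ mLen s → papp G (Fin.snoc c z) ≤ B) :
    ∃ W : M, W < mSmash (pbit true s) B ∧
      ∀ z, z ≤ mLen s → papp entry' ![W, z, B, s] = papp G (Fin.snoc c z) :=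
  ⟨papp (tbl' G) (Fin.snoc (Fin.snoc c B) s), tbl'_lt hM G c B s, fun z hz => by
    rw [entry'_tbl' hM G c B s hz, min_eq_left (hG z hz)]⟩

end PV1

end Literature.Analysis.FunctionSpaces
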